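import Summits.QuantumFields.YangMills.Theorems.BalabanStepParabolic.Negative.OverTunedShells
import Summits.QuantumFields.YangMills.Theorems.BalabanStepParabolic.Negative.CurvatureOnly
import Literature.MathematicalPhysics.QuantumFieldTheory.LatticeGaugeProofs
import HarnessLib

/-!
# `BalabanStepParabolic` — negative-side support: over-tuned thin inhabitant II (orbit values of the germ)

Part 2 of 4 (crux `stmt-QuantumFields-9684`, drefute gen 2). Elementary facts on `clampU`, `tentZ`, `γOf`;
the exact orbit values `germC_orbit`; (4a) `expectC_step` (identically, by `orbitRec`); `expectC_orbit`; (4b)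
**`expectC_wilson`** — at the junk Wilson point `(g, (1, g))` on the odd torus `2L+1` the functional IS Wilson's
centred `n`-point function at `β = κ/g²` with normalisations `cInd` (odd `M`); `continuous_FJ`; the linear
escape `iterate_φJ_one_ge`.
-/

namespace Summit.QuantumFields.YangMills.Theorems.BalabanStepParabolic.Negative

open scoped SchwartzMap
open MeasureTheory Filter Topology
open Literature.MathematicalPhysics.QuantumFieldTheory Literature.MathematicalPhysics.AQFT
open Literature.MathematicalPhysics.QuantumLattice

noncomputable section

/-! ### §4 The continuous germ of the over-tuned thin inhabitant -/

section Germ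

variable {G : Type} [Group G] [TopologicalSpace G] [IsTopologicalGroup G] [CompactSpace G]
  [MeasurableSpace G] [BorelSpace G] (r : LatticeRep G) (M : ℕ) (κ : ℝ)

/-- `clampU t ∈ [0, 1]`. [folklore] -/
theorem clampU_mem (t : ℝ) : 0 ≤ clampU t ∧ clampU t ≤ 1 :=
  ⟨le_max_left _ _, max_le zero_le_one (min_le_right _ _)⟩

/-- `clampU` is the identity on `[0, 1]`. [folklore] -/
theorem clampU_of_mem {t : ℝ} (h0 : 0 ≤ t) (h1 : t ≤ 1) : clampU t = t := by
  unfold clampU; rw [min_eq_left h1, max_eq_right h0]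

/-- `clampU t = 0` for `t ≤ 0`. [folklore] -/
theorem clampU_of_nonpos {t : ℝ} (h : t ≤ 0) : clampU t = 0 := by
  unfold clampU; exact max_eq_left ((min_le_left _ _).trans h)

/-- `clampU t = 1` for `t ≥ 1`. [folklore] -/
theorem clampU_of_one_le {t : ℝ} (h : 1 ≤ t) : clampU t = 1 := by
  unfold clampU; rw [min_eq_right h, max_eq_right zero_le_one]

/-- `clampU` is continuous. [folklore] -/
theorem continuous_clampU : Continuous clampU := by unfold clampU; fun_prop

/-- `tentZ u ∈ [0, 1]`. [folklore] -/
theorem tentZ_mem (u : ℝ) : 0 ≤ tentZ u ∧ tentZ u ≤ 1 :=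
  ⟨le_max_left _ _, max_le zero_le_one (by linarith [abs_nonneg u])⟩

/-- `tentZ 0 = 1`. [folklore] -/
@[simp] theorem tentZ_zero : tentZ 0 = 1 := by simp [tentZ]

/-- `tentZ u = 0` for `|u| ≥ 1`. [folklore] -/
theorem tentZ_eq_zero {u : ℝ} (h : 1 ≤ |u|) : tentZ u = 0 := by
  unfold tentZ; exact max_eq_left (by linarith)

/-- `tentZ` is continuous. [folklore] -/
theorem continuous_tentZ : Continuous tentZ := by unfold tentZ; fun_prop

/-- `γOf q ∈ [0, 1]`. [folklore] -/
theorem γOf_mem (q : ℝ × (ℝ × ℝ)) : 0 ≤ γOf q ∧ γOf q ≤ 1 := clampU_mem _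

/-- **The germ at an orbit point of a junk Wilson point** returns exactly the Wilson data (4b) demands
(read with normalisations `cInd`). [folklore] -/
theorem germC_orbit (n : ℕ) (σ : Fin n → YMSpecies G) {g : ℝ} (hg : g ∈ Set.Ioc (0 : ℝ) 1)
    (k S₀ : ℕ) (h : Fin n → 𝓢(EuclideanSpace ℝ (Fin 4), ℝ)) :
    germC r M κ n σ ((FJ M)^[k] (g, ((1 : ℝ), g))) S₀ h =
      if Odd S₀ then
        wilsonCentredSchwinger r.ρ (κ / g ^ 2) ((M ^ k * S₀ - 1) / 2) (cInd r) n σ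
          (fun i => (blockDilate M)^[k] (h i))
      else 0 := by
  classical
  rw [FJ_iterate]
  have hpk : 0 < (1 / 2 : ℝ) ^ k := by positivity
  have hγ : γOf ((φJ M)^[k] g, (1 / 2 : ℝ) ^ k, (1 / 2 : ℝ) ^ k * g) = g := by
    unfold γOf
    simp only
    rw [mul_div_cancel_left₀ g hpk.ne', clampU_of_mem hg.1.le hg.2]
  unfold germC
  simp only
  rw [kIdx_half_pow, shellW_half_pow, hγ, sub_self, tentZ_zero, one_mul, one_mul]
  by_cases hσ : ∀ i, σ i = r.curvature
  · rw [if_pos hσ]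
    by_cases hodd : Odd S₀
    · rw [if_pos hodd, if_pos hodd, wilsonCentredSchwinger_cInd, if_pos hσ]
      cases n with
      | zero =>
        rw [if_pos rfl, wilsonCentredSchwinger_zero]
        haveI := isProbabilityMeasure_wilsonMeasure (d := 4) (L := 2 * ((M ^ k * S₀ - 1) / 2) + 1) r.ρ
          r.continuous (κ / g ^ 2)
        exact probReal_univ.symm
      | succ m =>
        rw [if_neg (Nat.succ_ne_zero m)]
        unfold Efn dataW
        rw [if_pos hg.1]
    · rw [if_neg hodd, if_neg hodd]
  · rw [if_neg hσ]
    by_cases hodd : Odd S₀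
    · rw [if_pos hodd, wilsonCentredSchwinger_cInd, if_neg hσ]
    · rw [if_neg hodd]

variable (hM : 2 ≤ M)

/-- (4a) holds identically. [folklore] -/
theorem expectC_step (n : ℕ) (σ : Fin n → YMSpecies G) (p : ℝ × (ℝ × ℝ)) (S : ℕ)
    (f : Fin n → 𝓢(EuclideanSpace ℝ (Fin 4), ℝ)) :
    expectC r M κ hM n σ (FJ M p) S f =
      expectC r M κ hM n σ p (M * S) (fun i => blockDilate M (f i)) := by
  have hM0 : M ≠ 0 := by omega
  by_cases hS : S = 0
  · subst hS
    unfold expectC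
    rw [mul_zero, orbitRec_of_not _ _ _ hM _ 0 _ (by simp), orbitRec_of_not _ _ _ hM _ 0 _ (by simp)]
    have h0 : ∀ (q : ℝ × (ℝ × ℝ)) (h : Fin n → 𝓢(EuclideanSpace ℝ (Fin 4), ℝ)),
        germC r M κ n σ q 0 h = 0 := by
      intro q h
      unfold germC
      rw [if_neg (by decide : ¬ Odd 0)]
      split_ifs <;> rfl
    rw [h0, h0]
  · unfold expectC
    rw [orbitRec_mul _ _ _ hM p hS]
    congr 1
    funext i
    exact (blockContract_blockDilate hM0 (f i)).symm

/-- **Orbit values**: at depth `k` of the orbit of `(g, (1, g))`, on the torus `S'`, the functional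
returns the genuine Wilson data on the torus `M^k S'` (when odd; `M` odd) at `β = κ/g²` with `k`-fold
dilated test functions, normalisations `cInd`. [folklore] -/
theorem expectC_orbit (hMo : Odd M) (n : ℕ) (σ : Fin n → YMSpecies G) {g : ℝ}
    (hg : g ∈ Set.Ioc (0 : ℝ) 1) (S' k : ℕ) (h : Fin n → 𝓢(EuclideanSpace ℝ (Fin 4), ℝ)) :
    expectC r M κ hM n σ ((FJ M)^[k] (g, ((1 : ℝ), g))) S' h =
      if Odd (M ^ k * S') then
        wilsonCentredSchwinger r.ρ (κ / g ^ 2) ((M ^ k * S' - 1) / 2) (cInd r) n σ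
          (fun i => (blockDilate M)^[k] (h i))
      else 0 := by
  have hM0 : M ≠ 0 := by omega
  induction S' using Nat.strong_induction_on generalizing k h with
  | _ S' ih =>
    by_cases hdiv : S' ≠ 0 ∧ M ∣ S'
    · obtain ⟨S'', rfl⟩ := hdiv.2
      have hS'' : S'' ≠ 0 := by rintro rfl; exact hdiv.1 (by simp)
      have hlt : S'' < M * S'' := by
        have : 1 * S'' < M * S'' := Nat.mul_lt_mul_of_pos_right (by omega) (Nat.pos_of_ne_zero hS'')
        simpa using this
      unfold expectC
      rw [orbitRec_mul _ _ _ hM _ hS'', ← Function.iterate_succ_apply' (FJ M) k]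
      have := ih S'' hlt (k + 1) (contractTuple M h)
      unfold expectC at this
      rw [this]
      have hpow : M ^ (k + 1) * S'' = M ^ k * (M * S'') := by ring
      have hfun : (fun i => (blockDilate M)^[k + 1] (contractTuple M h i)) =
          fun i => (blockDilate M)^[k] (h i) := by
        funext i
        rw [Function.iterate_succ_apply]
        simp [contractTuple, blockDilate_blockContract hM0]
      rw [hpow, hfun]
    · unfold expectC
      rw [orbitRec_of_not _ _ _ hM _ _ _ hdiv, germC_orbit r M κ n σ hg k S' h]
      have hiff : Odd S' ↔ Odd (M ^ k * S') := by
        rw [Nat.odd_mul]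
        exact ⟨fun h => ⟨hMo.pow, h⟩, fun h => h.2⟩
      simp only [hiff]

/-- (4b): at the junk Wilson point `(g, (1, g))` on the odd torus `2L+1` the functional IS Wilson's
centred `n`-point function at `β = κ/g²` with normalisations `cInd`. [folklore] -/
theorem expectC_wilson (hMo : Odd M) (n : ℕ) (σ : Fin n → YMSpecies G) {g : ℝ}
    (hg : g ∈ Set.Ioc (0 : ℝ) 1) (L : ℕ) (f : Fin n → 𝓢(EuclideanSpace ℝ (Fin 4), ℝ)) :
    expectC r M κ hM n σ (g, ((1 : ℝ), g)) (2 * L + 1) f =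
      wilsonCentredSchwinger r.ρ (κ / g ^ 2) L (cInd r) n σ f := by
  have h := expectC_orbit r M κ hM hMo n σ hg (2 * L + 1) 0 f
  simp only [Function.iterate_zero, id_eq, pow_zero, one_mul] at h
  rw [h, if_pos ⟨L, rfl⟩]
  congr 1
  omega

/-- The junk step is continuous. [folklore] -/
theorem continuous_FJ : Continuous (FJ M) := by unfold FJ φJ; fun_prop

/-- From `1` the junk flow escapes to infinity at least linearly: `1 + k b ≤ φ^k(1)`. [folklore] -/
theorem iterate_φJ_one_ge (hb : 0 ≤ Real.log M) (k : ℕ) : 1 + k * Real.log M ≤ (φJ M)^[k] 1 := by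
  induction k with
  | zero => simp
  | succ k ih =>
    rw [Function.iterate_succ_apply']
    set y := (φJ M)^[k] 1 with hy
    have h0 : (0 : ℝ) ≤ k * Real.log M := by positivity
    have hy1 : 1 ≤ y := by linarith
    have hy3 : 1 ≤ y ^ 3 := one_le_pow₀ hy1
    have : y + Real.log M ≤ φJ M y := by
      unfold φJ; nlinarith
    push_cast; linarith

end Germ

end

end Summit.QuantumFields.YangMills.Theorems.BalabanStepParabolic.Negative
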